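import Mathlib
import HarnessLib
import Summits.Ventures.LatticeQCDFlow.Exactness.IMHKernel
import Summits.Ventures.LatticeQCDFlow.Exactness.DoeblinObservables

/-!
# Exact samplers with INEXACT weights: a flow sampler run with log-weights in error by at most `ε` everywhere is an exact sampler for a
# target within `(e^{2ε} − 1)/(e^{2ε} + 1) = tanh ε` of the true one in total variation — the systematic error of finite-precision actions
# and Jacobians, separated from the Monte Carlo error

HONEST FRAMING: exact (Metropolis-corrected) sampling algorithms for lattice gauge theory;
figures of merit are autocorrelation/cost numbers at stated couplings and volumes; no
continuum-physics claim.

Venture `LatticeQCDFlow` (cell pub-lqcd), topic `Exactness`; FANOUT row 30 (lean-1, GEN-42).  NEW WORK of the cell (general measurable state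
space; Mathlib + the tree's `IMHKernel` and `DoeblinObservables.abs_integral_sub_integral_le_of_setwise`).  Every certified error bar of the
programme assumes the accept/reject step evaluates the weight `w = e^{−S}/q̃` exactly; in practice `log w` (action, flow log-Jacobian) is computed
in finite precision.  The accept/reject step with the COMPUTED weight `w'` is still an exact sampler — for `π' ∝ w'·q` — so the only effect of a
uniform log-weight error `|log w' − log w| ≤ ε` is a change of target, bounded here sharply.  The tree's `KernelTVPerturbation` treats
setwise-close KERNELS (errors accumulate with time); a perturbed exact sampler has NO accumulation: its bias is the distance of the targets.

## Results (no `sorry`, no new definitions)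
* §1 DENSITY-RATIO BRACKET ⇒ TOTAL VARIATION.  `π` a probability law, `π' = r·π` a probability law with `m ≤ r ≤ M`, `m ≤ 1 ≤ M`, `m < M`:
  `le_mul_div_add_of_le_of_le` (`d ≤ αp`, `d ≤ β(1 − p)` ⇒ `d ≤ αβ/(α + β)`), `withDensity_real_apply_eq_setIntegral`,
  **`abs_real_sub_le_of_density_bounds`** — `|π'(A) − π(A)| ≤ (M − 1)(1 − m)/(M − m)` for every measurable `A` (sharp: two-valued densities);
  **`abs_integral_sub_le_of_density_bounds`** — `|∫ g dπ' − ∫ g dπ| ≤ (M − 1)(1 − m)/(M − m)` for measurable `0 ≤ g ≤ 1`.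
* §2 THE FLOW SAMPLER WITH A COMPUTED WEIGHT.  `q` the flow law, `w > 0` the true normalised weight (`∫ w dq = 1`, `π = w·q`), `w' > 0` the
  computed weight with `e^{−ε}w ≤ w' ≤ e^{ε}w`:  `indepMH_smul_weight` (the sampler is blind to the normaliser: `indepMH q (c·w') = indepMH q w'`),
  `computedTarget_isProbability`, **`computedWeight_invariant`** — `indepMH q w'` leaves the normalised computed target `π' = (w'/Z')·q`,
  `Z' = ∫ w' dq ∈ [e^{−ε}, e^{ε}]` (`normaliser_mem_Icc`), invariant: IT IS AN EXACT SAMPLER FOR `π'`; `computedTarget_eq_withDensity` (`π' = r·π`,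
  `r = w'/(Z'w) ∈ [e^{−2ε}, e^{2ε}]`); **`computedWeight_tv_le`** — `|π'(A) − π(A)| ≤ (e^{2ε} − 1)/(e^{2ε} + 1)` for every measurable `A`,
  `tanh_eq_exp_ratio` (that bound IS `tanh ε`), **`computedWeight_observable_le`** — `|∫ g dπ' − ∫ g dπ| ≤ tanh ε` for `0 ≤ g ≤ 1`.
Reading (gauge files): single-precision evaluation of `S` and of the flow's log-Jacobian with a uniform error `ε` (in nats) leaves the
sampler exact for a law within `tanh ε` (`≈ ε` for small `ε`) of the Wilson-type target in total variation, uniformly in the run length — only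
`ε` itself carries the volume dependence; this bias is NOT reduced by more samples and must be added to every certificate.  NOT CLAIMED: any value
of `ε` for a given code; non-uniform (configuration-dependent) error models; anything about the proposal sampler's own round-off.
-/

noncomputable section

namespace Summit.Ventures.LatticeQCDFlow.Exactness

open MeasureTheory ProbabilityTheory
open scoped ENNReal

variable {Ω : Type*} [MeasurableSpace Ω]

/-! ## §1 A density-ratio bracket bounds the total variation -/

/-- `d ≤ α·p` and `d ≤ β·(1 − p)` with `α, β ≥ 0`, `α + β > 0` give `d ≤ αβ/(α + β)`. [folklore] -/
theorem le_mul_div_add_of_le_of_le {d α β p : ℝ} (hα : 0 ≤ α) (hβ : 0 ≤ β) (hαβ : 0 < α + β) (h1 : d ≤ α * p) (h2 : d ≤ β * (1 - p)) :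
    d ≤ α * β / (α + β) := by
  rw [le_div_iff₀ hαβ]
  nlinarith [mul_le_mul_of_nonneg_left h1 hβ, mul_le_mul_of_nonneg_left h2 hα]

/-- `(r·π)(A) = ∫_A r dπ` in real numbers, for a nonnegative integrable density. [ours, bookkeeping] -/
theorem withDensity_real_apply_eq_setIntegral (π : Measure Ω) {r : Ω → ℝ} (hr0 : ∀ x, 0 ≤ r x) (hri : Integrable r π)
    {A : Set Ω} (hA : MeasurableSet A) :
    (π.withDensity fun x => ENNReal.ofReal (r x)).real A = ∫ x in A, r x ∂π := by
  rw [measureReal_def, withDensity_apply _ hA, ← ofReal_integral_eq_lintegral_ofReal hri.integrableOn (ae_of_all _ fun x => hr0 x),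
    ENNReal.toReal_ofReal (setIntegral_nonneg hA fun x _ => hr0 x)]

/-- One-sided form: `π'(A) − π(A) ≤ (M − 1)(1 − m)/(M − m)`. [ours] -/
theorem real_sub_le_of_density_bounds (π : Measure Ω) [IsProbabilityMeasure π] {r : Ω → ℝ} (hr : Measurable r) {m M : ℝ}
    (hm0 : 0 ≤ m) (hm : ∀ x, m ≤ r x) (hM : ∀ x, r x ≤ M) (hm1 : m ≤ 1) (hM1 : 1 ≤ M) (hmM : m < M)
    [IsProbabilityMeasure (π.withDensity fun x => ENNReal.ofReal (r x))] {A : Set Ω} (hA : MeasurableSet A) :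
    (π.withDensity fun x => ENNReal.ofReal (r x)).real A - π.real A ≤ (M - 1) * (1 - m) / (M - m) := by
  set π' := π.withDensity fun x => ENNReal.ofReal (r x) with hπ'
  have hr0 : ∀ x, 0 ≤ r x := fun x => hm0.trans (hm x)
  have hri : Integrable r π := Integrable.of_bound hr.aestronglyMeasurable M (ae_of_all _ fun x => by
    rw [Real.norm_eq_abs, abs_of_nonneg (hr0 x)]; exact hM x)
  have hp0 : 0 ≤ π.real A := measureReal_nonneg
  have hp1 : π.real A ≤ 1 := measureReal_le_one
  -- `π'(A) ≤ M·π(A)`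
  have h1 : π'.real A - π.real A ≤ (M - 1) * π.real A := by
    rw [hπ', withDensity_real_apply_eq_setIntegral π hr0 hri hA]
    have : ∫ x in A, r x ∂π ≤ ∫ _ in A, M ∂π := setIntegral_mono hri.integrableOn (integrableOn_const) fun x => hM x
    rw [setIntegral_const, smul_eq_mul] at this
    linarith
  -- `π'(Aᶜ) ≥ m·π(Aᶜ)`
  have h2 : π'.real A - π.real A ≤ (1 - m) * (1 - π.real A) := by
    have hc : π'.real Aᶜ - π.real Aᶜ ≥ (m - 1) * π.real Aᶜ := by
      rw [hπ', withDensity_real_apply_eq_setIntegral π hr0 hri hA.compl]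
      have : ∫ _ in Aᶜ, m ∂π ≤ ∫ x in Aᶜ, r x ∂π := setIntegral_mono (integrableOn_const) hri.integrableOn fun x => hm x
      rw [setIntegral_const, smul_eq_mul] at this
      linarith
    rw [probReal_compl_eq_one_sub hA, probReal_compl_eq_one_sub hA] at hc
    linarith
  have h := le_mul_div_add_of_le_of_le (by linarith) (by linarith) (by linarith) h1 h2
  have heq : (M - 1) + (1 - m) = M - m := by ring
  rwa [heq] at h

/-- **A DENSITY-RATIO BRACKET BOUNDS THE TOTAL VARIATION**: if `π' = r·π` is a probability law with `m ≤ r ≤ M` (`0 ≤ m ≤ 1 ≤ M`, `m < M`), then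
`|π'(A) − π(A)| ≤ (M − 1)(1 − m)/(M − m)` for every measurable `A` (the value attained by a two-valued density). [ours] -/
theorem abs_real_sub_le_of_density_bounds (π : Measure Ω) [IsProbabilityMeasure π] {r : Ω → ℝ} (hr : Measurable r) {m M : ℝ}
    (hm0 : 0 ≤ m) (hm : ∀ x, m ≤ r x) (hM : ∀ x, r x ≤ M) (hm1 : m ≤ 1) (hM1 : 1 ≤ M) (hmM : m < M)
    [IsProbabilityMeasure (π.withDensity fun x => ENNReal.ofReal (r x))] {A : Set Ω} (hA : MeasurableSet A) :
    |(π.withDensity fun x => ENNReal.ofReal (r x)).real A - π.real A| ≤ (M - 1) * (1 - m) / (M - m) := by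
  rw [abs_le]
  refine ⟨?_, real_sub_le_of_density_bounds π hr hm0 hm hM hm1 hM1 hmM hA⟩
  have hc := real_sub_le_of_density_bounds π hr hm0 hm hM hm1 hM1 hmM hA.compl
  rw [probReal_compl_eq_one_sub hA, probReal_compl_eq_one_sub hA] at hc
  linarith

/-- … and every `[0, 1]`-valued measurable observable: `|∫ g dπ' − ∫ g dπ| ≤ (M − 1)(1 − m)/(M − m)`. [ours — via the tree's
`abs_integral_sub_integral_le_of_setwise`] -/
theorem abs_integral_sub_le_of_density_bounds (π : Measure Ω) [IsProbabilityMeasure π] {r : Ω → ℝ} (hr : Measurable r) {m M : ℝ}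
    (hm0 : 0 ≤ m) (hm : ∀ x, m ≤ r x) (hM : ∀ x, r x ≤ M) (hm1 : m ≤ 1) (hM1 : 1 ≤ M) (hmM : m < M)
    [IsProbabilityMeasure (π.withDensity fun x => ENNReal.ofReal (r x))] {g : Ω → ℝ} (hg : Measurable g) (h0 : ∀ x, 0 ≤ g x)
    (h1 : ∀ x, g x ≤ 1) :
    |∫ x, g x ∂(π.withDensity fun x => ENNReal.ofReal (r x)) - ∫ x, g x ∂π| ≤ (M - 1) * (1 - m) / (M - m) :=
  abs_integral_sub_integral_le_of_setwise (fun _ hA => abs_real_sub_le_of_density_bounds π hr hm0 hm hM hm1 hM1 hmM hA) hg h0 h1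

/-! ## §2 The flow sampler with a computed (inexact) weight -/

variable {q : Measure Ω} [IsProbabilityMeasure q] {w w' : Ω → ℝ}

omit [MeasurableSpace Ω] in
/-- The acceptance is blind to the normaliser: `min(1, c·w'(y)/(c·w'(x))) = min(1, w'(y)/w'(x))`. [ours, bookkeeping] -/
theorem imhAccept_smul_weight {c : ℝ} (hc : 0 < c) (x y : Ω) : imhAccept (fun z => c * w' z) x y = imhAccept w' x y := by
  unfold imhAccept
  rw [mul_div_mul_left _ _ hc.ne']

/-- **THE SAMPLER IS BLIND TO THE NORMALISER**: `indepMH q (c·w') = indepMH q w'` for every `c > 0`. [ours] -/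
theorem indepMH_smul_weight {c : ℝ} (hc : 0 < c) : indepMH q (fun z => c * w' z) = indepMH q w' := by
  have ha : imhAcceptE (fun z => c * w' z) = imhAcceptE w' := by
    funext x y; rw [imhAcceptE, imhAcceptE, imhAccept_smul_weight hc]
  have hm : imhAcceptMass q (fun z => c * w' z) = imhAcceptMass q w' := by
    funext x; rw [imhAcceptMass, imhAcceptMass, ha]
  rw [indepMH, indepMH, ha, hm]

omit [IsProbabilityMeasure q] in
/-- The computed normaliser `Z' = ∫ w' dq` lies in `[e^{−ε}, e^{ε}]` when `e^{−ε}w ≤ w' ≤ e^{ε}w` and `∫ w dq = 1`. [ours] -/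
theorem normaliser_mem_Icc (hw'm : Measurable w') {ε : ℝ} (hlo : ∀ x, Real.exp (-ε) * w x ≤ w' x)
    (hhi : ∀ x, w' x ≤ Real.exp ε * w x) (hwi : Integrable w q) (h1 : ∫ x, w x ∂q = 1) (hw0 : ∀ x, 0 < w x) :
    Real.exp (-ε) ≤ ∫ x, w' x ∂q ∧ ∫ x, w' x ∂q ≤ Real.exp ε := by
  have hw'i : Integrable w' q := Integrable.mono' (hwi.const_mul (Real.exp ε)) hw'm.aestronglyMeasurable (ae_of_all _ fun x => by
    rw [Real.norm_eq_abs, abs_of_nonneg (le_trans (mul_nonneg (Real.exp_pos _).le (hw0 x).le) (hlo x))]; exact hhi x)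
  constructor
  · calc Real.exp (-ε) = ∫ x, Real.exp (-ε) * w x ∂q := by rw [integral_const_mul, h1, mul_one]
      _ ≤ ∫ x, w' x ∂q := integral_mono (hwi.const_mul _) hw'i hlo
  · calc ∫ x, w' x ∂q ≤ ∫ x, Real.exp ε * w x ∂q := integral_mono hw'i (hwi.const_mul _) hhi
      _ = Real.exp ε := by rw [integral_const_mul, h1, mul_one]

/-- The normalised computed target `π' = (w'/Z')·q` is a probability law. [ours, bookkeeping] -/
theorem computedTarget_isProbability (hw'0 : ∀ x, 0 < w' x) (hw'i : Integrable w' q) :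
    IsProbabilityMeasure (q.withDensity fun x => ENNReal.ofReal (w' x / ∫ y, w' y ∂q)) := by
  have hZ : 0 < ∫ y, w' y ∂q := (integral_pos_iff_support_of_nonneg (fun x => (hw'0 x).le) hw'i).2 (by
    have : Function.support w' = Set.univ := Set.eq_univ_of_forall fun x => (hw'0 x).ne'
    rw [this, measure_univ]; exact one_pos)
  refine ⟨?_⟩
  rw [withDensity_apply _ MeasurableSet.univ, Measure.restrict_univ,
    ← ofReal_integral_eq_lintegral_ofReal (hw'i.div_const _) (ae_of_all _ fun x => div_nonneg (hw'0 x).le hZ.le),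
    integral_div, div_self hZ.ne', ENNReal.ofReal_one]

/-- **THE FLOW SAMPLER WITH THE COMPUTED WEIGHT IS EXACT FOR THE COMPUTED TARGET**: `indepMH q w'` leaves `π' = (w'/Z')·q` invariant (and is
reversible for it) — whatever the relation of `w'` to the true weight. [ours] -/
theorem computedWeight_invariant (hw'm : Measurable w') (hw'0 : ∀ x, 0 < w' x) (hw'i : Integrable w' q) :
    Kernel.Invariant (indepMH q w') (q.withDensity fun x => ENNReal.ofReal (w' x / ∫ y, w' y ∂q)) := by
  have hZ : 0 < ∫ y, w' y ∂q := (integral_pos_iff_support_of_nonneg (fun x => (hw'0 x).le) hw'i).2 (by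
    have : Function.support w' = Set.univ := Set.eq_univ_of_forall fun x => (hw'0 x).ne'
    rw [this, measure_univ]; exact one_pos)
  have h := indepMH_invariant (q := q) (w := fun x => (∫ y, w' y ∂q)⁻¹ * w' x) (hw'm.const_mul _)
    (fun x => mul_pos (inv_pos.2 hZ) (hw'0 x))
  rw [indepMH_smul_weight (inv_pos.2 hZ)] at h
  simp_rw [inv_mul_eq_div] at h
  exact h

omit [IsProbabilityMeasure q] in
/-- **The computed target as a perturbation of the true one**: `π' = r·π` with `r = w'/(Z'·w)`. [ours, bookkeeping] -/
theorem computedTarget_eq_withDensity (hw : Measurable w) (hw0 : ∀ x, 0 < w x) (hw'm : Measurable w') :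
    (q.withDensity fun x => ENNReal.ofReal (w' x / ∫ y, w' y ∂q)) =
      (q.withDensity fun x => ENNReal.ofReal (w x)).withDensity fun x => ENNReal.ofReal (w' x / ((∫ y, w' y ∂q) * w x)) := by
  rw [← withDensity_mul _ hw.ennreal_ofReal (by fun_prop)]
  congr 1
  funext x
  rw [Pi.mul_apply, ← ENNReal.ofReal_mul (hw0 x).le]
  congr 1
  field_simp [(hw0 x).ne']

/-- `tanh ε = (e^{2ε} − 1)/(e^{2ε} + 1)`. [folklore] -/
theorem tanh_eq_exp_ratio (ε : ℝ) : Real.tanh ε = (Real.exp (2 * ε) - 1) / (Real.exp (2 * ε) + 1) := by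
  rw [Real.tanh_eq_sinh_div_cosh, Real.sinh_eq, Real.cosh_eq]
  have h2 : Real.exp (2 * ε) = Real.exp ε * Real.exp ε := by rw [two_mul, Real.exp_add]
  have hne : Real.exp ε ≠ 0 := (Real.exp_pos ε).ne'
  rw [h2, Real.exp_neg]
  field_simp

/-- `(M − 1)(1 − M⁻¹)/(M − M⁻¹) = (M − 1)/(M + 1)` for `M > 1`. [folklore] -/
theorem ratio_bound_eq {M : ℝ} (hM : 1 < M) : (M - 1) * (1 - M⁻¹) / (M - M⁻¹) = (M - 1) / (M + 1) := by
  have hM0 : 0 < M := by linarith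
  have hinv : M⁻¹ < 1 := inv_lt_one_of_one_lt₀ hM
  have hd : M - M⁻¹ ≠ 0 := by linarith
  rw [div_eq_div_iff hd (by linarith)]
  field_simp
  ring

/-- **THE BIAS OF AN INEXACT WEIGHT IS AT MOST `tanh ε` IN TOTAL VARIATION**: with `e^{−ε}w ≤ w' ≤ e^{ε}w` (log-weight error at most `ε`
everywhere), the normalised computed target satisfies `|π'(A) − π(A)| ≤ (e^{2ε} − 1)/(e^{2ε} + 1)` for every measurable `A`. [ours] -/
theorem computedWeight_tv_le (hw : Measurable w) (hw0 : ∀ x, 0 < w x) (h1 : ∫ x, w x ∂q = 1) (hw'm : Measurable w') {ε : ℝ} (hε : 0 < ε)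
    (hlo : ∀ x, Real.exp (-ε) * w x ≤ w' x) (hhi : ∀ x, w' x ≤ Real.exp ε * w x) {A : Set Ω} (hA : MeasurableSet A) :
    |(q.withDensity fun x => ENNReal.ofReal (w' x / ∫ y, w' y ∂q)).real A - (q.withDensity fun x => ENNReal.ofReal (w x)).real A| ≤
      (Real.exp (2 * ε) - 1) / (Real.exp (2 * ε) + 1) := by
  have hwi : Integrable w q := by
    by_contra h; rw [integral_undef h] at h1; exact zero_ne_one h1
  have hw'0 : ∀ x, 0 < w' x := fun x => lt_of_lt_of_le (mul_pos (Real.exp_pos _) (hw0 x)) (hlo x)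
  have hw'i : Integrable w' q := Integrable.mono' (hwi.const_mul (Real.exp ε)) hw'm.aestronglyMeasurable (ae_of_all _ fun x => by
    rw [Real.norm_eq_abs, abs_of_nonneg (hw'0 x).le]; exact hhi x)
  obtain ⟨hZlo, hZhi⟩ := normaliser_mem_Icc (q := q) hw'm hlo hhi hwi h1 hw0
  set Z := ∫ y, w' y ∂q with hZ
  have hZpos : 0 < Z := lt_of_lt_of_le (Real.exp_pos _) hZlo
  haveI hπ : IsProbabilityMeasure (q.withDensity fun x => ENNReal.ofReal (w x)) :=
    ⟨by rw [withDensity_apply _ MeasurableSet.univ, Measure.restrict_univ,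
      ← ofReal_integral_eq_lintegral_ofReal hwi (ae_of_all _ fun x => (hw0 x).le), h1, ENNReal.ofReal_one]⟩
  haveI hπ' := computedTarget_isProbability (q := q) hw'0 hw'i
  rw [computedTarget_eq_withDensity hw hw0 hw'm]
  haveI : IsProbabilityMeasure ((q.withDensity fun x => ENNReal.ofReal (w x)).withDensity
      fun x => ENNReal.ofReal (w' x / ((∫ y, w' y ∂q) * w x))) := by
    rw [← computedTarget_eq_withDensity hw hw0 hw'm]; exact hπ'
  -- the density ratio `r = w'/(Z w)` lies in `[e^{-2ε}, e^{2ε}]`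
  have hrlo : ∀ x, Real.exp (-(2 * ε)) ≤ w' x / (Z * w x) := fun x => by
    rw [le_div_iff₀ (mul_pos hZpos (hw0 x))]
    calc Real.exp (-(2 * ε)) * (Z * w x) = (Real.exp (-ε) * Z) * (Real.exp (-ε) * w x) := by
          rw [show -(2 * ε) = -ε + -ε by ring, Real.exp_add]; ring
      _ ≤ 1 * (Real.exp (-ε) * w x) := by
          refine mul_le_mul_of_nonneg_right ?_ (mul_nonneg (Real.exp_pos _).le (hw0 x).le)
          calc Real.exp (-ε) * Z ≤ Real.exp (-ε) * Real.exp ε := mul_le_mul_of_nonneg_left hZhi (Real.exp_pos _).le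
            _ = 1 := by rw [← Real.exp_add, neg_add_cancel, Real.exp_zero]
      _ ≤ w' x := by rw [one_mul]; exact hlo x
  have hrhi : ∀ x, w' x / (Z * w x) ≤ Real.exp (2 * ε) := fun x => by
    rw [div_le_iff₀ (mul_pos hZpos (hw0 x))]
    calc w' x ≤ Real.exp ε * w x := hhi x
      _ = (Real.exp ε * Real.exp (-ε)) * (Real.exp ε * w x) := by rw [← Real.exp_add, add_neg_cancel, Real.exp_zero, one_mul]
      _ ≤ (Real.exp ε * Z) * (Real.exp ε * w x) :=
          mul_le_mul_of_nonneg_right (mul_le_mul_of_nonneg_left hZlo (Real.exp_pos _).le) (mul_nonneg (Real.exp_pos _).le (hw0 x).le)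
      _ = Real.exp (2 * ε) * (Z * w x) := by rw [two_mul, Real.exp_add]; ring
  have hm1 : Real.exp (-(2 * ε)) ≤ 1 := by rw [Real.exp_le_one_iff]; linarith
  have hM1 : 1 ≤ Real.exp (2 * ε) := Real.one_le_exp (by linarith)
  have hmM : Real.exp (-(2 * ε)) < Real.exp (2 * ε) := Real.exp_lt_exp.2 (by linarith)
  have h := abs_real_sub_le_of_density_bounds (q.withDensity fun x => ENNReal.ofReal (w x))
    ((hw'm.div ((measurable_const.mul hw)))) (Real.exp_pos _).le hrlo hrhi hm1 hM1 hmM hA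
  refine h.trans (le_of_eq ?_)
  rw [Real.exp_neg]
  exact ratio_bound_eq (by rw [← Real.exp_zero]; exact Real.exp_lt_exp.2 (by linarith))

/-- **… AND AT MOST `tanh ε` ON EVERY `[0, 1]`-VALUED OBSERVABLE**: `|∫ g dπ' − ∫ g dπ| ≤ tanh ε`. [ours] -/
theorem computedWeight_observable_le (hw : Measurable w) (hw0 : ∀ x, 0 < w x) (h1 : ∫ x, w x ∂q = 1) (hw'm : Measurable w') {ε : ℝ}
    (hε : 0 < ε) (hlo : ∀ x, Real.exp (-ε) * w x ≤ w' x) (hhi : ∀ x, w' x ≤ Real.exp ε * w x) {g : Ω → ℝ} (hg : Measurable g)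
    (h0 : ∀ x, 0 ≤ g x) (hg1 : ∀ x, g x ≤ 1) :
    |∫ x, g x ∂(q.withDensity fun x => ENNReal.ofReal (w' x / ∫ y, w' y ∂q)) - ∫ x, g x ∂(q.withDensity fun x => ENNReal.ofReal (w x))| ≤
      Real.tanh ε := by
  have hwi : Integrable w q := by
    by_contra h; rw [integral_undef h] at h1; exact zero_ne_one h1
  have hw'0 : ∀ x, 0 < w' x := fun x => lt_of_lt_of_le (mul_pos (Real.exp_pos _) (hw0 x)) (hlo x)
  have hw'i : Integrable w' q := Integrable.mono' (hwi.const_mul (Real.exp ε)) hw'm.aestronglyMeasurable (ae_of_all _ fun x => by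
    rw [Real.norm_eq_abs, abs_of_nonneg (hw'0 x).le]; exact hhi x)
  haveI hπ : IsProbabilityMeasure (q.withDensity fun x => ENNReal.ofReal (w x)) :=
    ⟨by rw [withDensity_apply _ MeasurableSet.univ, Measure.restrict_univ,
      ← ofReal_integral_eq_lintegral_ofReal hwi (ae_of_all _ fun x => (hw0 x).le), h1, ENNReal.ofReal_one]⟩
  haveI hπ' := computedTarget_isProbability (q := q) hw'0 hw'i
  rw [tanh_eq_exp_ratio]
  exact abs_integral_sub_integral_le_of_setwise (fun _ hA => computedWeight_tv_le hw hw0 h1 hw'm hε hlo hhi hA) hg h0 hg1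

end Summit.Ventures.LatticeQCDFlow.Exactness
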